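import Summits.NavierStokesRegularity.NavierStokesRegularity.Theses.AxisymmetricExtremality

set_option linter.dupNamespace false
/-! # Census sketches (crux-strategist, MinimalDatumPFold): the strengthenings S2, S3 of STRATEGY-CENSUS.md TYPED
over existing declarations (elaboration check only; nothing here is filed). -/

namespace Summit.NavierStokesRegularity.NavierStokesRegularity.Cruxes.MinimalDatumPFold.CensusSketch

/-- S3 (strengthen-to-induct, the 2-adic tower): the Z/2-extremality STEP inside the `2^k`-fold symmetric class —
if a `2^k`-fold (a.e.) symmetric blow-up datum exists below level `r`, then `2^(k+1)`-fold symmetric blow-up data exist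
below `r + ε` for every `ε > 0`. With `k`-induction from the unrestricted threshold this gives `stub_symmGapClosing`
for `p = 2^k`; the step at `k = 0` (half-turn symmetry for free) is already the whole difficulty. -/
def TwoAdicStep : Prop :=
  ∀ ν : ℝ, 0 < ν → ∀ (k : ℕ) (r : ENNReal), (∃ (u₀ : EuclideanSpace ℝ (Fin 3) → EuclideanSpace ℝ (Fin 3)) (g : Literature.Analysis.FunctionSpaces.HomSobolev (EuclideanSpace ℝ (Fin 3)) (EuclideanSpace ℂ (Fin 3)) (1 / 2 : ℝ)), MeasureTheory.MemLp u₀ 3 (MeasureTheory.volume : MeasureTheory.Measure (EuclideanSpace ℝ (Fin 3))) ∧ g.Represents (Literature.Analysis.FunctionSpaces.EuclideanSpace.complexify ∘ u₀) ∧ Literature.Analysis.FluidPDE.IsWeaklyDivFree u₀ ∧ ¬ Literature.Analysis.FluidPDE.HasGlobalKatoSolution ν u₀ ∧ ‖g‖ₑ < r ∧ ∀ᵐ x ∂(MeasureTheory.volume : MeasureTheory.Measure (EuclideanSpace ℝ (Fin 3))), u₀ (WithLp.toLp 2 ![Real.cos (2 * Real.pi / ((2 ^ k : ℕ) : ℝ))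 * x 0 - Real.sin (2 * Real.pi / ((2 ^ k : ℕ) : ℝ)) * x 1, Real.sin (2 * Real.pi / ((2 ^ k : ℕ) : ℝ)) * x 0 + Real.cos (2 * Real.pi / ((2 ^ k : ℕ) : ℝ)) * x 1, x 2]) = WithLp.toLp 2 ![Real.cos (2 * Real.pi / ((2 ^ k : ℕ) : ℝ)) * u₀ x 0 - Real.sin (2 * Real.pi / ((2 ^ k : ℕ) : ℝ)) * u₀ x 1, Real.sin (2 * Real.pi / ((2 ^ k : ℕ) : ℝ)) * u₀ x 0 + Real.cos (2 * Real.pi / ((2 ^ k : ℕ) : ℝ)) * u₀ x 1, u₀ x 2]) → ∀ ε : ENNReal, 0 < ε → ∃ (u₀ : EuclideanSpace ℝ (Fin 3) → EuclideanSpace ℝ (Fin 3)) (g : Literature.Analysis.FunctionSpaces.HomSobolev (EuclideanSpace ℝ (Fin 3)) (EuclideanSpace ℂ (Fin 3)) (1 / 2 : ℝ)), MeasureTheory.MemLp u₀ 3 (MeasureTheory.volume : MeasureTheory.Measure (EuclideanSpace ℝ (Fin 3))) ∧ g.Represents (Literature.Analysis.FunctionSpaces.EuclideanSpace.complexify ∘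 u₀) ∧ Literature.Analysis.FluidPDE.IsWeaklyDivFree u₀ ∧ ¬ Literature.Analysis.FluidPDE.HasGlobalKatoSolution ν u₀ ∧ ‖g‖ₑ < r + ε ∧ ∀ᵐ x ∂(MeasureTheory.volume : MeasureTheory.Measure (EuclideanSpace ℝ (Fin 3))), u₀ (WithLp.toLp 2 ![Real.cos (2 * Real.pi / ((2 ^ (k + 1) : ℕ) : ℝ)) * x 0 - Real.sin (2 * Real.pi / ((2 ^ (k + 1) : ℕ) : ℝ)) * x 1, Real.sin (2 * Real.pi / ((2 ^ (k + 1) : ℕ) : ℝ)) * x 0 + Real.cos (2 * Real.pi / ((2 ^ (k + 1) : ℕ) : ℝ)) * x 1, x 2]) = WithLp.toLp 2 ![Real.cos (2 * Real.pi / ((2 ^ (k + 1) : ℕ) : ℝ)) * u₀ x 0 - Real.sin (2 * Real.pi / ((2 ^ (k + 1) : ℕ) : ℝ)) * u₀ x 1, Real.sin (2 * Real.pi / ((2 ^ (k + 1) : ℕ) : ℝ)) * u₀ x 0 + Real.cos (2 * Real.pi / ((2 ^ (k + 1) : ℕ) : ℝ)) * u₀ x 1, u₀ x 2]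

/-- S2 (the NLS-shaped rigidity): EVERY minimal blow-up datum is axisymmetric about some axis (direction given by a
linear isometry `A` applied to the `x₂`-axis, through the point `c`), a.e. Stronger than AXB; no handle. -/
def EveryMinimalDatumAxisymmetric : Prop :=
  ∀ ν : ℝ, 0 < ν → ∀ (u₀ : EuclideanSpace ℝ (Fin 3) → EuclideanSpace ℝ (Fin 3)) (g : Literature.Analysis.FunctionSpaces.HomSobolev (EuclideanSpace ℝ (Fin 3)) (EuclideanSpace ℂ (Fin 3)) (1 / 2 : ℝ)), Literature.Analysis.FluidPDE.IsMinimalBlowupDatum ν u₀ g → ∃ (A : EuclideanSpace ℝ (Fin 3) ≃ₗᵢ[ℝ] EuclideanSpace ℝ (Fin 3)) (c : EuclideanSpace ℝ (Fin 3)), ∀ θ : ℝ, ∀ᵐ x ∂(MeasureTheory.volume : MeasureTheory.Measure (EuclideanSpace ℝ (Fin 3))), u₀ (A (WithLp.toLp 2 ![Real.cos θ * (A.symm (x - c)) 0 - Real.sin θ * (A.symm (x - c)) 1, Real.sin θ * (A.symm (x - c)) 0 + Real.cos θ * (A.symm (x - c)) 1, (A.symm (x - c)) 2]) + c) = A (WithLp.toLp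 2 ![Real.cos θ * (A.symm (u₀ x)) 0 - Real.sin θ * (A.symm (u₀ x)) 1, Real.sin θ * (A.symm (u₀ x)) 0 + Real.cos θ * (A.symm (u₀ x)) 1, (A.symm (u₀ x)) 2])

end Summit.NavierStokesRegularity.NavierStokesRegularity.Cruxes.MinimalDatumPFold.CensusSketch
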